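import Literature.MathematicalPhysics.QuantumLattice.WightmanLocality
import Literature.MathematicalPhysics.QuantumLattice.WightmanPermutedTubeLocal
import HarnessLib

/-!
# The symmetric continuation: reduction of the global step to the geometry of the extended tube

Topic `Literature/MathematicalPhysics/QuantumLattice` (trunk T-AQFT). Assembly file (no new named
facts) in the decomposition of `IsWightmanQFT.exists_symmetric_continuation`
(`SchwingerWightmanSymmetry`): by `WightmanPermutedTube` that fact follows from the
Bargmann–Hall–Wightman continuation (A) `IsWightmanQFT.exists_invariant_continuation` and the
consistency under permutations (K) `IsWightmanQFT.extendedTube_continuation_perm_eq`. For (K),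
`WightmanLocality` proves the distributional local commutativity of the Wightman distributions
(Streater–Wightman Thm. 3-2 (d)) and `WightmanPermutedTubeLocal` proves Streater–Wightman Thm. 3-6
in its printed, local form (agreement of `𝔚` and `𝔚 ∘ σ` near the common real points of `𝒯'ₙ` and
`σ𝒯'ₙ`) together with its propagation along preconnected subsets by `L₊(ℂ)`-invariance. This file
puts the two together for Wightman QFTs:

* `IsWightmanQFT.continuation_perm_eq_nhds_of_real`: **Thm. 3-6 for the continued Wightman
  functions of one scalar field** — near every real `x ∈ 𝒯'ₙ` with `x ∘ σ ∈ 𝒯'ₙ`,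
  `𝔚(z ∘ σ) = 𝔚(z)`;
* `PermReachable d n` (a **geometric condition** on the extended tube, no field theory): for
  `σ ≠ 1`, every point `z` of `𝒯'ₙ ∩ σ𝒯'ₙ` lies in a preconnected subset of `𝒯'ₙ ∩ σ𝒯'ₙ` containing
  some `Λx`, `Λ ∈ L₊(ℂ)`, `x` a real point of `𝒯'ₙ ∩ σ𝒯'ₙ` (e.g. if every connected component of
  `𝒯'ₙ ∩ σ𝒯'ₙ` contains a real point; such real points exist for `d ≥ 2`,
  `exists_real_mem_relExtendedTube_perm`; trivially true for `d = 0`, it can fail for `d = 1`);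
* `IsWightmanQFT.extendedTube_continuation_perm_eq_of_permReachable`: **(K) follows from
  `PermReachable d n` for all `n`** — what remains of the "single valued" clause of
  Osterwalder–Schrader I §5 p. 97 (citing Jost (1965), p. 83) beyond the printed Thm. 3-6 is this
  statement about the geometry of `L₊(ℂ)𝒯ʳₙ`;
* `IsWightmanQFT.exists_symmetric_continuation_of_permReachable`: hence (A) and the geometric
  condition give `exists_symmetric_continuation`.

## Sources

* R. F. Streater, A. S. Wightman, *PCT, Spin and Statistics, and All That*: Thm. 3-2 (d)
  (pdf p. 96), Thm. 3-6 (pdf pp. 101–102), §2-4 Fig. 2-4 (pdf pp. 66–67). [StreaterWightman1964]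
* K. Osterwalder, R. Schrader, Comm. Math. Phys. 31 (1973), §5 p. 97. [OsterwalderSchraderCMP1973]
* R. Jost, *The General Theory of Quantized Fields* (1965), p. 83 (not held; acq-00689). [Jost1965]
-/

noncomputable section

open Filter Complex Set
open _root_.Topology
open scoped SchwartzMap

namespace Literature.MathematicalPhysics.QuantumLattice

variable {d : ℕ} {κ : Type*} {n : ℕ}

/-- **Streater–Wightman Theorem 3-6 for the continued Wightman functions of one hermitian scalar
field.** Let `𝔚` be analytic on the extended tube `𝒯'ₙ` with the `n`-point Wightman distribution of a
Wightman QFT (all labels equal) as distributional boundary value. If the real configuration `x` and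
its permutation `x ∘ σ` both lie in `𝒯'ₙ`, then `𝔚(z ∘ σ) = 𝔚(z)` for all `z` near `x` ("`W` and
`W_π` continue one another as one holomorphic function"; locality enters through
`IsWightmanQFT.isLocalDistribution`, S–W Thm. 3-2 (d)). [cite: StreaterWightman1964, Thm 3-6] -/
theorem IsWightmanQFT.continuation_perm_eq_nhds_of_real {W : WightmanData d κ} (hW : IsWightmanQFT W)
    {k : Fin n → κ} (hk : ∀ i j, k i = k j) {𝔚 : (Fin n → Fin (d + 1) → ℂ) → ℂ}
    (h𝔚 : AnalyticOnNhd ℂ 𝔚 (relExtendedTube d n)) {T : 𝓢((Fin n → SpaceTime d), ℂ) →L[ℂ] ℂ}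
    (hT : IsWightmanDistributionOf W n k T) (hbv : HasDistributionalBoundaryValue 𝔚 T)
    (σ : Equiv.Perm (Fin n)) {x : Fin n → SpaceTime d}
    (hx : (fun i => complexifyPoint (x i)) ∈ relExtendedTube d n)
    (hxσ : (fun i => complexifyPoint (x (σ i))) ∈ relExtendedTube d n) :
    ∀ᶠ z in 𝓝 (fun i => complexifyPoint (x i)), 𝔚 (fun i => z (σ i)) = 𝔚 z :=
  perm_eq_nhds_of_real h𝔚 hbv (hW.isLocalDistribution hT hk) σ hx hxσ

/-- **Reachability of real points in `𝒯'ₙ ∩ σ𝒯'ₙ`** (a geometric condition on the extended tube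
`𝒯'ₙ = ⋃_{Λ ∈ L₊(ℂ)} Λ𝒯ʳₙ`, used below only as a hypothesis; no claim is made here that it holds): for
every permutation `σ ≠ 1`, every `z ∈ 𝒯'ₙ` with `z ∘ σ ∈ 𝒯'ₙ` lies in a preconnected set `U` of such
points which contains a point `Λx` with `Λ ∈ L₊(ℂ)` and `x` real, `x ∈ 𝒯'ₙ`, `x ∘ σ ∈ 𝒯'ₙ`. It holds,
for instance, if every connected component of `𝒯'ₙ ∩ σ𝒯'ₙ` (`σ ≠ 1`) contains a real point. Facts
about it proved in the tree: for space dimension `d ≥ 2` common real points of `𝒯'ₙ` and `σ𝒯'ₙ` exist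
for every `σ` (`exists_real_mem_relExtendedTube_perm`, S–W §2-4 Fig. 2-4); for `d = 0` the condition
holds trivially (`L₊(ℂ)` is trivial and `𝒯ʳₙ ∩ σ𝒯ʳₙ = ∅` for `σ ≠ 1`). For `d = 1` it can fail
(`n = 3`, `σ = (0 1)`: `𝒯'₃ ∩ σ𝒯'₃` is non-empty but has no real points, totally space-like triples in
`1 + 1` dimensions being ordered chains), so this reduction of (K) is aimed at `d ≥ 2`; whether the
condition holds there is the open geometric question it isolates. [folklore] -/
def PermReachable (d n : ℕ) : Prop :=
  ∀ (σ : Equiv.Perm (Fin n)), σ ≠ 1 → ∀ (z : Fin n → Fin (d + 1) → ℂ),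
    z ∈ relExtendedTube d n → (fun i => z (σ i)) ∈ relExtendedTube d n →
    ∃ U : Set (Fin n → Fin (d + 1) → ℂ), IsPreconnected U ∧ U ⊆ relExtendedTube d n ∧
      (∀ w ∈ U, (fun i => w (σ i)) ∈ relExtendedTube d n) ∧ z ∈ U ∧
      ∃ (x : Fin n → SpaceTime d) (Λ : (Fin (d + 1) → ℂ) ≃ₗ[ℂ] (Fin (d + 1) → ℂ)),
        Λ ∈ properComplexLorentzGroup d ∧
        (fun i => complexifyPoint (x i)) ∈ relExtendedTube d n ∧
        (fun i => complexifyPoint (x (σ i))) ∈ relExtendedTube d n ∧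
        (fun i => Λ (complexifyPoint (x i))) ∈ U

/-- **(K) from the geometry of the extended tube.** If `PermReachable d n` holds for every `n`,
then the Bargmann–Hall–Wightman continuation of the Wightman functions of one scalar field is
consistent under permutations on the extended tube
(`IsWightmanQFT.extendedTube_continuation_perm_eq`): Streater–Wightman Thm. 3-2 (d) and Thm. 3-6
(`WightmanLocality`, `WightmanPermutedTubeLocal`) supply the agreement near the real points, the
reachability carries it over `𝒯'ₙ ∩ σ𝒯'ₙ` (`σ = 1` needs nothing). [folklore] -/
theorem IsWightmanQFT.extendedTube_continuation_perm_eq_of_permReachable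
    (hgeo : ∀ n, PermReachable d n) :
    IsWightmanQFT.extendedTube_continuation_perm_eq (d := d) (κ := κ) := by
  intro W hW n k hk 𝔚 h𝔚 hT hinv σ z hz hzσ
  obtain ⟨T, hTW, hbv⟩ := hT
  by_cases hσ : σ = 1
  · subst hσ; rfl
  · obtain ⟨U, hU, hUE, hUσ, hzU, x, Λ, hΛ, hx, hxσ, hΛx⟩ := hgeo n σ hσ z hz hzσ
    exact perm_eq_on_preconnected h𝔚 hbv (hW.isLocalDistribution hTW hk) hinv σ hU hUE hUσ hx hxσ
      hΛ hΛx z hzU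

/-- **The symmetric continuation from (A) and the geometry of the extended tube.**
`IsWightmanQFT.exists_symmetric_continuation` follows from the Bargmann–Hall–Wightman continuation
(`IsWightmanQFT.exists_invariant_continuation`, S–W Thm. 3-5 with Thm. 2-11) and the reachability
condition `PermReachable d n` for all `n` (gluing: `WightmanPermutedTube`). [folklore] -/
theorem IsWightmanQFT.exists_symmetric_continuation_of_permReachable
    (hA : IsWightmanQFT.exists_invariant_continuation (d := d) (κ := κ))
    (hgeo : ∀ n, PermReachable d n) :
    IsWightmanQFT.exists_symmetric_continuation (d := d) (κ := κ) :=
  IsWightmanQFT.exists_symmetric_continuation_of_perm_eq hA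
    (IsWightmanQFT.extendedTube_continuation_perm_eq_of_permReachable hgeo)

end Literature.MathematicalPhysics.QuantumLattice
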